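import Summits.QuantumFields.YangMills.Theses.PoincareLipschitz
import Summits.QuantumFields.YangMills.Theorems.AlphaInputsT3ACv3AvgIterLocality
import Literature.MathematicalPhysics.QuantumFieldTheory.Balaban1983to89.T3CovarianceRP
import Literature.MathematicalPhysics.QuantumFieldTheory.Balaban1983to89.T4ReTrLipUnitary
import HarnessLib

/-!
# Route `PoincareLipschitz` (planner ym-r3-idea-2 g7, LINE 15), support `BlockLocalityL` (stmt-QuantumFields-23534) — BY NAME

Tree facts about the observable `U ↦ dist1(Ū^j(∂a))(U)` — the distance to `1` of the holonomy of the `j`-fold Bałaban block average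
`Ū^j = avg^j U` (`Averaging.iter (blockAvg ℰp) j`) around a level-`j` plaquette `a` of the `K`-th approximation `F.P K` (`1 ≤ j`, `j + 2 ≤ K`):

1. GAUGE INVARIANCE — covariance of the iterated average (`T4Continuum.iter_gaugeAct`, [Balaban1985Averaging] (11)), conjugation of plaquette
   holonomies (`T4ReTrLipUnitary.plaqHol_gaugeAct`) and `dist1 (h g h⁻¹) = dist1 g` (`GaugeGroup.dist1_conj`);
2. MEASURABILITY — `T4Continuum.measurable_iter` (measurable averaging maps from the measurable small-loop average `ℰp`,
   `T3Family.avgMeasurable_of_measurableE`), `Missing.measurable_plaqHol`, `RegularGaugeGroup.measurable_dist1`;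
3. BOX LOCALITY — the holonomy of `avg^j U` around `a` reads `U` only on the finest bonds with both endpoints in the four `j`-blocks of the
   corners of `a` (`AvgIterLocality.plaqHol_iter_congr₂_of_blocks_subset`, [Balaban1987RG1] (0.4)+(0.11)); those blocks lie in the box
   `corner(a)·L^j + [−8L^j, 9L^j)³` of the statement: a fine site `x` over a corner `y` has label `x_k = y_k·L^j + t`, `t < L^j`, with
   `y_k ≡ (a.src)_k + e (mod 2L^{m+K−j})`, `e ∈ {0,1}`, so `x_k − (a.src)_k L^j + 8L^j ≡ eL^j + t + 8L^j (mod 2L^{m+K})`, a natural number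
   `< 10 L^j ≤ 17 L^j` (and `< 2L^{m+K}` since `m + K − j ≥ 3`, `L ≥ 3`).

Width seat ym-line-sfw-p2-w2 g23 (cell ym-idea-1, R3 family; free hands), `--workitem stmt-QuantumFields-23534`.  Bookkeeping only; no crux, rung (R3 is a
RECORD rung) or summit is proved; the Yang–Mills mass gap is NOT proved.
-/

set_option autoImplicit false

namespace Summit.QuantumFields.YangMills.Theorems.PoincareLipschitz

open Literature.MathematicalPhysics.QuantumFieldTheory.Balaban1983to89
open Literature.MathematicalPhysics.QuantumFieldTheory.Balaban1983to89.T3ContinuumYM3Torus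
open Literature.MathematicalPhysics.QuantumFieldTheory.Balaban1983to89.T3UnitLawDensityEML
open Literature.MathematicalPhysics.QuantumFieldTheory.Balaban1983to89.B5Eq118OneStroke (iterBlockOf val_iterBlockOf)

/-- A coordinate of a corner of the level-`j` plaquette `a` is `(a.src)_k` or `(a.src)_k + 1`. [folklore] -/
theorem corner_coord {P : Params} {j : ℕ} (a : Plaq P j) (y : Site P j)
    (hy : y = a.src ∨ y = a.src.shift a.μ ∨ y = a.src.shift a.ν ∨ y = (a.src.shift a.μ).shift a.ν) (k : Fin P.d) :
    ∃ e : ℕ, e ≤ 1 ∧ y k = a.src k + (e : ZMod (P.sitesPerDir j)) := by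
  rcases hy with rfl | rfl | rfl | rfl
  · exact ⟨0, by norm_num, by simp⟩
  · by_cases hk : k = a.μ
    · subst hk; exact ⟨1, le_rfl, by simp [Site.shift]⟩
    · exact ⟨0, by norm_num, by simp [Site.shift, hk]⟩
  · by_cases hk : k = a.ν
    · subst hk; exact ⟨1, le_rfl, by simp [Site.shift]⟩
    · exact ⟨0, by norm_num, by simp [Site.shift, hk]⟩
  · by_cases hkν : k = a.ν
    · subst hkν
      by_cases hkμ : a.ν = a.μ
      · exact absurd hkμ (ne_of_gt a.hμν)
      · exact ⟨1, le_rfl, by simp [Site.shift, hkμ]⟩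
    · by_cases hkμ : k = a.μ
      · subst hkμ; exact ⟨1, le_rfl, by simp [Site.shift, Function.update_apply, hkν]⟩
      · exact ⟨0, by norm_num, by simp [Site.shift, Function.update_apply, hkμ, hkν]⟩

/-- **Box of the corner blocks.**  If the `j`-fold block of the fine site `x` is a corner of the level-`j` plaquette `a` (`j ≤ m + K − 3`), then
every label of `x` lies in the window `(a.src)_k L^j + [−8L^j, 9L^j)` (read modulo `2L^{m+K}`). [folklore] -/
theorem mem_window_of_corner (F : T3Family) {K j : ℕ} (hjK : j + 2 ≤ K) (a : Plaq (F.P K) j) (x : Site (F.P K) 0)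
    (hx : iterBlockOf j x = a.src ∨ iterBlockOf j x = a.src.shift a.μ ∨ iterBlockOf j x = a.src.shift a.ν ∨
      iterBlockOf j x = (a.src.shift a.μ).shift a.ν) (k : Fin (F.P K).d) :
    (x k - ((((a.src k).val * F.L ^ j : ℕ)) : ZMod ((F.P K).sitesPerDir 0)) +
        ((8 * F.L ^ j : ℕ) : ZMod ((F.P K).sitesPerDir 0))).val < 17 * F.L ^ j := by
  -- notation and sizes
  have hL3 : 3 ≤ F.L := by obtain ⟨k, hk⟩ := F.hL.1; have := F.hL.2; omega
  have hPL : (F.P K).L = F.L := rfl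
  have hPm : (F.P K).m = F.m := rfl
  have hPK : (F.P K).K = K := rfl
  have hm1 : 1 ≤ F.m := F.hm
  have hjmK : j ≤ (F.P K).m + (F.P K).K := by rw [hPm, hPK]; omega
  set N0 : ℕ := (F.P K).sitesPerDir 0 with hN0
  set Nj : ℕ := (F.P K).sitesPerDir j with hNj
  have hN0eq : N0 = 2 * F.L ^ (F.m + K) := by simp [hN0, Params.sitesPerDir]
  have hNjeq : Nj = 2 * F.L ^ (F.m + K - j) := by simp [hNj, Params.sitesPerDir]
  have hN0Nj : N0 = Nj * F.L ^ j := by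
    rw [hN0eq, hNjeq, mul_assoc, ← pow_add, Nat.sub_add_cancel (by omega)]
  have hLj : 0 < F.L ^ j := by positivity
  -- `N0 ≥ 10 L^j`
  have hbig : 10 * F.L ^ j ≤ N0 := by
    rw [hN0Nj, hNjeq]
    have h3 : 3 ≤ F.m + K - j := by omega
    have hpow : 27 ≤ F.L ^ (F.m + K - j) :=
      calc 27 = 3 ^ 3 := by norm_num
        _ ≤ F.L ^ 3 := Nat.pow_le_pow_left hL3 3
        _ ≤ F.L ^ (F.m + K - j) := Nat.pow_le_pow_right (by omega) h3
    nlinarith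
  -- the corner coordinate
  obtain ⟨e, he1, hye⟩ := corner_coord a (iterBlockOf j x) hx k
  set v : ℕ := (x k).val with hv
  set s : ℕ := (a.src k).val with hs
  set w : ℕ := ((iterBlockOf j x) k).val with hw
  have hvw : w = v / F.L ^ j := by rw [hw, hv, ← hPL]; exact val_iterBlockOf j hjmK x k
  have hsNj : s < Nj := ZMod.val_lt _
  -- `w ≡ s + e (mod Nj)`
  have hmod : w % Nj = (s + e) % Nj := by
    have h1 : ((w : ℕ) : ZMod Nj) = ((s + e : ℕ) : ZMod Nj) := by
      rw [hw, hs, ZMod.natCast_zmod_val, Nat.cast_add, ZMod.natCast_zmod_val, hye]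
    exact (ZMod.natCast_eq_natCast_iff' _ _ _).mp h1
  -- hence `w L^j ≡ (s + e) L^j (mod N0)`
  have hmod0 : (w * F.L ^ j) % N0 = ((s + e) * F.L ^ j) % N0 := by
    rw [hN0Nj]
    exact (Nat.ModEq.mul_right' (F.L ^ j) hmod)
  -- `v = w L^j + t`
  set t : ℕ := v % F.L ^ j with ht
  have htlt : t < F.L ^ j := Nat.mod_lt _ hLj
  have hvdec : v = w * F.L ^ j + t := by
    rw [hvw, ht]; exact (Nat.div_add_mod' v (F.L ^ j)).symm
  -- the element of the statement is the cast of `e L^j + t + 8 L^j`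
  have helt : x k - ((((a.src k).val * F.L ^ j : ℕ)) : ZMod N0) + ((8 * F.L ^ j : ℕ) : ZMod N0) =
      ((e * F.L ^ j + t + 8 * F.L ^ j : ℕ) : ZMod N0) := by
    have hx' : x k = ((v : ℕ) : ZMod N0) := by rw [hv, ZMod.natCast_zmod_val]
    have hwc : ((w * F.L ^ j : ℕ) : ZMod N0) = (((s + e) * F.L ^ j : ℕ) : ZMod N0) :=
      (ZMod.natCast_eq_natCast_iff' _ _ _).mpr hmod0
    rw [hx', hvdec, ← hs]
    push_cast
    have hwc' : ((w : ℕ) : ZMod N0) * (F.L : ZMod N0) ^ j = (((s : ℕ) : ZMod N0) + (e : ZMod N0)) * (F.L : ZMod N0) ^ j := by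
      have := hwc; push_cast at this; exact this
    rw [hwc']
    ring
  rw [helt, ZMod.val_natCast]
  have hlt : e * F.L ^ j + t + 8 * F.L ^ j < 10 * F.L ^ j := by nlinarith
  rw [Nat.mod_eq_of_lt (lt_of_lt_of_le hlt hbig)]
  omega

/-- ★ **`PoincareLipschitz.BlockLocalityL`** (item stmt-QuantumFields-23534) BY NAME: gauge invariance, measurability and box locality of
`U ↦ dist1(Ū^j(∂a))(U)`. [folklore] -/
theorem blockLocalityL_proof : Summit.QuantumFields.YangMills.Theses.PoincareLipschitz.BlockLocalityL := by
  intro F K j hj hjK a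
  have hPm : (F.P K).m = F.m := rfl
  have hPK : (F.P K).K = K := rfl
  have hjmK : j ≤ (F.P K).m + (F.P K).K := by rw [hPm, hPK]; omega
  refine ⟨?_, ?_, ?_⟩
  · -- gauge invariance
    intro u U
    show GaugeGroup.dist1 (GaugeField.plaqHol (Averaging.iter
        (fun i' => BlockAveraging.blockAvg (P := F.P K) (j := i') ℰp) j (GaugeField.gaugeAct u U)) a) =
      GaugeGroup.dist1 (GaugeField.plaqHol (Averaging.iter (fun i' => BlockAveraging.blockAvg (P := F.P K) (j := i') ℰp) j U) a)
    rw [T4Continuum.iter_gaugeAct _ u j hjmK U, T4ReTrLipUnitary.plaqHol_gaugeAct, GaugeGroup.dist1_conj]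
  · -- measurability
    exact RegularGaugeGroup.measurable_dist1.comp ((Missing.measurable_plaqHol a).comp
      (T4Continuum.measurable_iter _ (F.avgMeasurable_of_measurableE ℰp measurableE_ℰp K) j))
  · -- box locality
    intro U U' hUU'
    set S : Set (Site (F.P K) 0) := {x | ∀ k : Fin (F.P K).d,
      (x k - ((((a.src k).val * F.L ^ j : ℕ)) : ZMod ((F.P K).sitesPerDir 0)) +
        ((8 * F.L ^ j : ℕ) : ZMod ((F.P K).sitesPerDir 0))).val < 17 * F.L ^ j} with hSdef
    have hS : ∀ b : PBond (F.P K) 0, b.src ∈ S → b.tgt ∈ S → U b = U' b := fun b hb1 hb2 => hUU' b hb1 hb2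
    have hQ : ∀ x : Site (F.P K) 0, (iterBlockOf j x = a.src ∨ iterBlockOf j x = a.src.shift a.μ ∨
        iterBlockOf j x = a.src.shift a.ν ∨ iterBlockOf j x = (a.src.shift a.μ).shift a.ν) → x ∈ S :=
      fun x hx k => mem_window_of_corner F hjK a x hx k
    have h := AvgIterLocality.plaqHol_iter_congr₂_of_blocks_subset
      (fun i' => (BlockAveraging.blockAvg (P := F.P K) (j := i') ℰp : Averaging (F.P K) i' _))
      (fun _ => T4ReflectionConeSharp.twoBlockLocal_blockAvg ℰp) hjmK S hS a hQ
    rw [h]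

end Summit.QuantumFields.YangMills.Theorems.PoincareLipschitz
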